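import Mathlib
import HarnessLib
import Summits.HubbardSuperconductivity.HubbardSuperconductivity.Theorems.KLProgrammeKLRegimeVolumeLimitFrameReduction
import Literature.MathematicalPhysics.QuantumLattice.HubbardTruncatedHartree

/-!
# Child 5 `KLRegimeVolumeLimitV7` (stmt-HubbardSuperconductivity-19665) — the COUPLING EXPANSION of the carrier of the volume-limit
# text at finite `(β, L, M)`: rational structure in `U`, and its first derivative at `U = 0` (seat hubbard-kl-k3c5-p2)

By the frame reduction (`…VolumeLimitFrameReduction`): `βL² ĝ_K(k)² Σ̂^K_{L,M}(k,σ;U) = N(U)/D(U) + βL² ĝ_K(k)` with the BARE Gaussian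
integrals `N(U) = ∫dμ_C ψ̂⁺_{kσ}ψ̂⁻_{kσ} e^{−V(U)}`, `D(U) = ∫dμ_C e^{−V(U)}`.  Since `V(U) = U · W` (`W = hubbardInteraction … 1`, nilpotent),
`e^{−V(U)} = Σ_{j<J} (−U)ʲ/j! · Wʲ` is a POLYNOMIAL in `U` with Grassmann coefficients (`grassmannExp_neg_hubbardInteraction_eq_sum`), so
`N`, `D` are polynomials in `U` (`§1`), `D(0) = 1`, `N(0) = ⟨ψ̂⁺ψ̂⁻⟩₀ = −βL² ĝ₀(k)`, `D'(0) = −∫dμ_C W`, `N'(0) = −∫dμ_C ψ̂⁺ψ̂⁻W` (`§2`), and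
the carrier `U ↦ klSelfEnergy L M β U μ K klE0 (nScales β + 1) k σ` is differentiable at `U = 0` with

  `d/dU|₀ Σ̂^K(k,σ;U) = −(∫dμ_C ψ̂⁺_{kσ}ψ̂⁻_{kσ}W − ⟨ψ̂⁺ψ̂⁻⟩₀ ∫dμ_C W) / (βL² ĝ_K(k)²)`

(`hasDerivAt_klSelfEnergy_nScales_succ_zero`): the truncated (connected) first-order insertion, re-amputated with the frame propagator —
the ORDER-`U¹` RUNG of child 5 in structural form (its Wick evaluation — the frame-dressed Hartree tadpole — and its VL-shaped volume limit
are the sequel).  Higher rungs are the higher derivatives of the same two polynomials.  Everything is proved; no definition.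
-/

noncomputable section

namespace Summit.HubbardSuperconductivity.HubbardSuperconductivity.Theorems.TwoPointAssembly

set_option linter.dupNamespace false -- summit = problem name (single-conjunct summit), D-0017

open Finset Filter Topology Literature.MathematicalPhysics.QuantumLattice Literature.Probability.LatticeModels GrassmannAlgebra
open Summit.HubbardSuperconductivity.HubbardSuperconductivity.Theorems.KLRegimeSplit
open Summit.HubbardSuperconductivity.HubbardSuperconductivity.Theorems.KLProgrammeLegKernels

variable {L M : ℕ} [NeZero L]

/-! ## §1 `e^{−V(U)}` is a polynomial in `U` -/

/-- `V(U) = U · W`, `W = V(1)`. -/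
theorem hubbardInteraction_eq_smul_one (β U : ℝ) : hubbardInteraction L M β U = (U : ℂ) • hubbardInteraction L M β 1 := by
  rw [hubbardInteraction, hubbardInteraction, smul_smul]
  congr 1
  push_cast
  ring

/-- **`e^{−V(U)} = Σ_{j<J} ((−U)ʲ/j!) · Wʲ`** for every `J` with `W^J = 0` (`W = V(1)` nilpotent). -/
theorem grassmannExp_neg_hubbardInteraction_eq_sum (β U : ℝ) {J : ℕ} (hJ : hubbardInteraction L M β 1 ^ J = 0) :
    grassmannExp (-(hubbardInteraction L M β U)) =
      ∑ j ∈ range J, (((-U) ^ j / j.factorial : ℝ) : ℂ) • hubbardInteraction L M β 1 ^ j := by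
  have hnil : (-(hubbardInteraction L M β U)) ^ J = 0 := by
    rw [hubbardInteraction_eq_smul_one, ← neg_smul, smul_pow, hJ, smul_zero]
  rw [grassmannExp, IsNilpotent.exp_eq_sum hnil]
  refine Finset.sum_congr rfl fun j _ => ?_
  rw [hubbardInteraction_eq_smul_one β U, ← neg_smul, smul_pow, inv_natCast_smul_eq ℚ ℂ, smul_smul]
  congr 1
  push_cast
  ring

/-- A nilpotency exponent of `W = V(1)` that is at least `2`. -/
theorem exists_hubbardInteraction_one_pow_eq_zero (β : ℝ) : ∃ J : ℕ, 2 ≤ J ∧ hubbardInteraction L M β 1 ^ J = 0 := by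
  obtain ⟨J₀, hJ₀⟩ := isNilpotent_of_constPart_eq_zero ℂ (constPart_hubbardInteraction L M β 1)
  exact ⟨J₀ + 2, by omega, by rw [pow_add, hJ₀, zero_mul]⟩

/-- **Gaussian integrals against `e^{−V(U)}` are polynomials in `U`**: `∫dμ_C F e^{−V(U)} = Σ_{j<J} ((−U)ʲ/j!) ∫dμ_C F Wʲ`. -/
theorem gaussExpect_mul_grassmannExp_neg_eq_sum (C : Matrix (HubbardFieldIdx L M) (HubbardFieldIdx L M) ℂ) (F : HubbardGrassmann L M)
    (β U : ℝ) {J : ℕ} (hJ : hubbardInteraction L M β 1 ^ J = 0) :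
    gaussExpect ℂ C (F * grassmannExp (-(hubbardInteraction L M β U))) =
      ∑ j ∈ range J, (((-U) ^ j / j.factorial : ℝ) : ℂ) * gaussExpect ℂ C (F * hubbardInteraction L M β 1 ^ j) := by
  rw [grassmannExp_neg_hubbardInteraction_eq_sum β U hJ, Finset.mul_sum, map_sum]
  refine Finset.sum_congr rfl fun j _ => ?_
  rw [mul_smul_comm, map_smul, smul_eq_mul]

/-! ## §2 The coupling polynomials and their derivatives at `U = 0` -/

/-- The derivative at `0` of a coupling polynomial `U ↦ Σ_{j<J} ((−U)ʲ/j!) c_j` (`J ≥ 2`) is `−c₁`. -/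
theorem hasDerivAt_couplingPoly (c : ℕ → ℂ) {J : ℕ} (hJ : 2 ≤ J) :
    HasDerivAt (fun U : ℝ => ∑ j ∈ range J, (((-U) ^ j / j.factorial : ℝ) : ℂ) * c j) (-c 1) 0 := by
  have hterm : ∀ j : ℕ, HasDerivAt (fun U : ℝ => (((-U) ^ j / j.factorial : ℝ) : ℂ) * c j)
      ((((j : ℝ) * (-(0 : ℝ)) ^ (j - 1) * (-1) / j.factorial : ℝ) : ℂ) * c j) 0 := by
    intro j
    have h1 : HasDerivAt (fun U : ℝ => (-U) ^ j / (j.factorial : ℝ)) ((j : ℝ) * (-(0 : ℝ)) ^ (j - 1) * (-1) / j.factorial) 0 :=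
      ((hasDerivAt_neg (0 : ℝ)).pow j).div_const _
    exact (h1.ofReal_comp).mul_const (c j)
  refine (HasDerivAt.fun_sum (u := range J) fun j _ => hterm j).congr_deriv ?_
  rw [Finset.sum_eq_single 1]
  · simp
  · intro j _ hj
    rcases Nat.lt_or_gt_of_ne hj with h | h
    · have : j = 0 := by omega
      subst this; simp
    · have : (-(0 : ℝ)) ^ (j - 1) = 0 := by rw [neg_zero]; exact zero_pow (by omega)
      rw [this]; simp
  · intro h; exact absurd (Finset.mem_range.2 (by omega)) h

/-- **`N(U) = ∫dμ_C F e^{−V(U)}` is differentiable at `0` with `N'(0) = −∫dμ_C F·W`** (any `F`, any covariance). -/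
theorem hasDerivAt_gaussExpect_mul_grassmannExp_neg (C : Matrix (HubbardFieldIdx L M) (HubbardFieldIdx L M) ℂ)
    (F : HubbardGrassmann L M) (β : ℝ) :
    HasDerivAt (fun U : ℝ => gaussExpect ℂ C (F * grassmannExp (-(hubbardInteraction L M β U))))
      (-gaussExpect ℂ C (F * hubbardInteraction L M β 1)) 0 := by
  obtain ⟨J, hJ2, hJ⟩ := exists_hubbardInteraction_one_pow_eq_zero (L := L) (M := M) β
  have h := hasDerivAt_couplingPoly (fun j => gaussExpect ℂ C (F * hubbardInteraction L M β 1 ^ j)) hJ2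
  simp only [pow_one] at h
  refine h.congr_of_eventuallyEq (Eventually.of_forall fun U => ?_)
  exact gaussExpect_mul_grassmannExp_neg_eq_sum C F β U hJ

/-- `D(U) = ∫dμ_C e^{−V(U)}` is differentiable at `0` with `D'(0) = −∫dμ_C W`. -/
theorem hasDerivAt_effPartitionFn (C : Matrix (HubbardFieldIdx L M) (HubbardFieldIdx L M) ℂ) (β : ℝ) :
    HasDerivAt (fun U : ℝ => effPartitionFn ℂ C (hubbardInteraction L M β U))
      (-gaussExpect ℂ C (hubbardInteraction L M β 1)) 0 := by
  have h := hasDerivAt_gaussExpect_mul_grassmannExp_neg C 1 β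
  simp only [one_mul] at h
  exact h

/-- `D(0) = 1`. -/
theorem effPartitionFn_hubbardInteraction_zero (C : Matrix (HubbardFieldIdx L M) (HubbardFieldIdx L M) ℂ) (β : ℝ) :
    effPartitionFn ℂ C (hubbardInteraction L M β 0) = 1 := by
  rw [effPartitionFn_eq_gaussExpect, hubbardInteraction_zero_coupling, neg_zero, grassmannExp, IsNilpotent.exp_zero,
    gaussExpect_one]

/-- `N(0) = ∫dμ_C F`. -/
theorem gaussExpect_mul_grassmannExp_neg_zero (C : Matrix (HubbardFieldIdx L M) (HubbardFieldIdx L M) ℂ) (F : HubbardGrassmann L M)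
    (β : ℝ) : gaussExpect ℂ C (F * grassmannExp (-(hubbardInteraction L M β 0))) = gaussExpect ℂ C F := by
  rw [hubbardInteraction_zero_coupling, neg_zero, grassmannExp, IsNilpotent.exp_zero, mul_one]

/-! ## §3 The first `U`-derivative of the two-leg kernel -/

/-- **`d/dU|₀ Σ̂^K(k,σ;U) = (−∫dμ_C ψ̂⁺ψ̂⁻W + ⟨ψ̂⁺ψ̂⁻⟩₀ ∫dμ_C W)/(βL² ĝ_K(k)²)`** — the truncated first-order insertion, re-amputated
with the frame propagator (`β ≠ 0`; `C` = bare covariance, `W = V(1)`). -/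
theorem hasDerivAt_selfEnergy_fullActionCT_zero {β : ℝ} (hβ : β ≠ 0) (μ : ℝ) (K : TrigPolyC4v) (k : FreqMomentum L M) (σ : Fin 2) :
    HasDerivAt (fun U : ℝ => selfEnergy L M β (fullActionCT L M β U μ K) k σ)
      ((-gaussExpect ℂ (hubbardCovariance L M β μ 0)
            (gen ℂ (((k, σ), 0) : HubbardFieldIdx L M) * gen ℂ (((k, σ), 1) : HubbardFieldIdx L M) * hubbardInteraction L M β 1) +
          gaussExpect ℂ (hubbardCovariance L M β μ 0)
              (gen ℂ (((k, σ), 0) : HubbardFieldIdx L M) * gen ℂ (((k, σ), 1) : HubbardFieldIdx L M)) *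
            gaussExpect ℂ (hubbardCovariance L M β μ 0) (hubbardInteraction L M β 1)) /
        (((β * (L : ℝ) ^ 2 : ℝ) : ℂ) * propCT L M β μ K k ^ 2)) 0 := by
  have hβL : ((β * (L : ℝ) ^ 2 : ℝ) : ℂ) ≠ 0 := by
    have hL : (L : ℝ) ≠ 0 := by exact_mod_cast NeZero.ne L
    exact_mod_cast mul_ne_zero hβ (pow_ne_zero 2 hL)
  have hg := propCT_ne_zero (L := L) hβ μ K k
  set C := hubbardCovariance L M β μ 0 with hC
  set ab : HubbardGrassmann L M := gen ℂ (((k, σ), 0) : HubbardFieldIdx L M) * gen ℂ (((k, σ), 1) : HubbardFieldIdx L M)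
    with hab
  have hN := hasDerivAt_gaussExpect_mul_grassmannExp_neg C ab β
  have hD := hasDerivAt_effPartitionFn C β
  have hD0 : effPartitionFn ℂ C (hubbardInteraction L M β 0) = 1 := effPartitionFn_hubbardInteraction_zero C β
  have hN0 : gaussExpect ℂ C (ab * grassmannExp (-(hubbardInteraction L M β 0))) = gaussExpect ℂ C ab :=
    gaussExpect_mul_grassmannExp_neg_zero C ab β
  -- `D(U) ≠ 0` near `U = 0`
  have hDne : ∀ᶠ U : ℝ in 𝓝 0, effPartitionFn ℂ C (hubbardInteraction L M β U) ≠ 0 := by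
    have hc : ContinuousAt (fun U : ℝ => effPartitionFn ℂ C (hubbardInteraction L M β U)) 0 := hD.continuousAt
    have : effPartitionFn ℂ C (hubbardInteraction L M β (0 : ℝ)) ≠ 0 := by rw [hD0]; exact one_ne_zero
    exact hc.eventually_ne this
  -- the quotient rule for `N/D`, then the affine map of the frame reduction
  have hq := (hN.div hD (by rw [hD0]; exact one_ne_zero)).add_const (((β * (L : ℝ) ^ 2 : ℝ) : ℂ) * propCT L M β μ K k)
  have hq' := hq.div_const (((β * (L : ℝ) ^ 2 : ℝ) : ℂ) * propCT L M β μ K k ^ 2)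
  rw [hD0, hN0] at hq'
  have hfun : (fun U : ℝ => selfEnergy L M β (fullActionCT L M β U μ K) k σ) =ᶠ[𝓝 0] fun U : ℝ =>
      (gaussExpect ℂ C (ab * grassmannExp (-(hubbardInteraction L M β U))) / effPartitionFn ℂ C (hubbardInteraction L M β U) +
          ((β * (L : ℝ) ^ 2 : ℝ) : ℂ) * propCT L M β μ K k) /
        (((β * (L : ℝ) ^ 2 : ℝ) : ℂ) * propCT L M β μ K k ^ 2) := by
    filter_upwards [hDne] with U hU
    exact selfEnergy_fullActionCT_eq_bare_ratio hβ U μ K k σ hU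
  refine (hq'.congr_of_eventuallyEq hfun).congr_deriv ?_
  simp only [one_pow, div_one, mul_one]
  ring

/-- **The ORDER-`U¹` RUNG of the VL carrier, structural form**: for `β > 0` the carrier
`U ↦ klSelfEnergy L M β U μ K klE0 (nScales β + 1) k σ` is differentiable at `U = 0` with derivative
`(−∫dμ_C ψ̂⁺_{kσ}ψ̂⁻_{kσ}W + ⟨ψ̂⁺_{kσ}ψ̂⁻_{kσ}⟩₀ ∫dμ_C W)/(βL² ĝ_K(k)²)`. -/
theorem hasDerivAt_klSelfEnergy_nScales_succ_zero {β : ℝ} (hβ : 0 < β) (μ : ℝ) (K : TrigPolyC4v) (k : FreqMomentum L M)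
    (σ : Fin 2) :
    HasDerivAt (fun U : ℝ => klSelfEnergy L M β U μ K klE0 (nScales β + 1) k σ)
      ((-gaussExpect ℂ (hubbardCovariance L M β μ 0)
            (gen ℂ (((k, σ), 0) : HubbardFieldIdx L M) * gen ℂ (((k, σ), 1) : HubbardFieldIdx L M) * hubbardInteraction L M β 1) +
          gaussExpect ℂ (hubbardCovariance L M β μ 0)
              (gen ℂ (((k, σ), 0) : HubbardFieldIdx L M) * gen ℂ (((k, σ), 1) : HubbardFieldIdx L M)) *
            gaussExpect ℂ (hubbardCovariance L M β μ 0) (hubbardInteraction L M β 1)) /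
        (((β * (L : ℝ) ^ 2 : ℝ) : ℂ) * propCT L M β μ K k ^ 2)) 0 := by
  have hfun : (fun U : ℝ => klSelfEnergy L M β U μ K klE0 (nScales β + 1) k σ) =
      fun U : ℝ => selfEnergy L M β (fullActionCT L M β U μ K) k σ := by
    funext U
    rw [klSelfEnergy, klEffectiveAction_nScales_succ L M hβ, ← fullActionCT]
  rw [hfun]
  exact hasDerivAt_selfEnergy_fullActionCT_zero hβ.ne' μ K k σ

end Summit.HubbardSuperconductivity.HubbardSuperconductivity.Theorems.TwoPointAssembly

end
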